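import Summits.QuantumAdvantage.QuantumAdvantage.Theorems.LinnikCubicClassGroupsDegreeOnePrimesEscapeResidueStarkLemma
import Literature.NumberTheory.LFunctions.StarkNoQuadraticSubfieldProofs
import Literature.NumberTheory.LFunctions.ClassGroupLFunctionNoExceptionalZeroOddDegree
import HarnessLib

/-!
# An effective Brauer–Siegel LOWER bound `h_K · R_K ≥ c(n) · √|d_K| / log|d_K|` for number fields
# without quadratic subfield — hence for EVERY cubic (indeed every odd-degree) field

Topic `Summits/QuantumAdvantage/QuantumAdvantage/Theorems`, helper file of the (closed) crux
`DegreeOnePrimesEscape` (stmt-QuantumAdvantage-11543) of route `LinnikCubicClassGroups`; cell B2b-1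
(linnik-cubic), PART B.  HONEST FRAMING: the value of this file is a THEOREM — a kernel-checked
REPRODUCTION, with an explicit (weak) constant, of a classical effective result of Stark (1974) — NOT
summit progress.  Everything here is PROVED (theorems only, standard axioms).

What is proved (all constants explicit; `n = [K:ℚ]`, `d_K` the discriminant, `h_K` the class number,
`R_K` the regulator, `κ_K = Res_{s=1} ζ_K`):

* `residue_ge_inv_log_of_noQuadraticSubfield` — for every number field `K` of degree `n > 1` with NO
  quadratic subfield, `κ_K ≥ e^{−7} · 16^{−n} · (1/(4·n!)) / log|d_K|`: Stark's no-quadratic-subfield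
  zero-free interval `[1 − 1/(4·n!·log|d_K|), 1)` (tree theorem
  `Stark1974_dedekindZeta_ne_zero_of_noQuadraticSubfield_holds`, Stark 1974 Thm 3 / Lemma 3) fed into
  Stark's Lemma 4 (tree theorem `Residue.residue_ge_of_zeroFree`).  (The cell's earlier file
  `…ResidueBound.lean` weakened this to `κ_K ≥ Q^{−10}`; the `1/log` form is exported here.)
* `classNumber_mul_regulator_ge_of_noQuadraticSubfield` — for the same fields,
  `h_K · R_K ≥ (e^{−7} · 16^{−n} / (4·n!·(2π)^n)) · √|d_K| / log|d_K|`,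
  by Mathlib's analytic class number formula `κ_K = 2^{r₁}(2π)^{r₂} h_K R_K / (w_K √|d_K|)`
  (`NumberField.dedekindZeta_residue_def`) with `w_K ≥ 1` and `2^{r₁}(2π)^{r₂} ≤ (2π)^n`.
* `classNumber_mul_regulator_ge_of_odd` — the same for EVERY number field of ODD degree `n > 1`
  (an odd-degree field has no quadratic subfield, `forall_finrank_ne_two_of_odd`), in particular
* `sqrt_abs_discr_le_of_finrank_eq_three` — for EVERY cubic field, `√|d_K| ≤ 10¹¹ · h_K · R_K · log|d_K|`;
* `exists_classNumber_mul_regulator_ge`, `exists_classNumber_mul_regulator_ge_of_odd` — the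
  `∃ c(n) > 0` packagings.

PLACEMENT (presearch 2026-08-19; corpus fts+vec, arXiv 2024–26; OpenAlex/S2 rate-limited): this is the
no-quadratic-subfield case of Stark's effective Brauer–Siegel theorem [Stark1974, Thm 1 with Lemma 4 and
Thm 3] (`κ_K ≫_n 1/log|d_K|` when `K` has no quadratic subfield; Stark's printed constants are stronger
than the tree's `e^{−7}16^{−n}/(4·n!)`), cf. the survey lines of Cho–Lemke Oliver–Zaman, arXiv:2510.02309
§1 (2025; they extend Stark's bounds to all Artin `L`-functions, on paper) and [Bordellès 2006/2020,
Arithmetic Tales, Thm 7.24 and p. 433] (the general lower bound is ineffective).  Nearest 2024–26 items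
(Kandhil–Languasco–Moree arXiv:2402.13830, Dixit arXiv:2601.18408, Thorner arXiv:2608.12257) are
asymptotic / ineffective statements and do not overlap.  DELTA: none mathematically — a kernel-checked
proof with an explicit constant, for the record of the cell (it makes the Brauer–Siegel lower bound
unconditional and effective for the family of ALL cubic fields, the family of the booked FBQP theorem).

## References
* H. M. Stark, *Some effective cases of the Brauer–Siegel theorem*, Invent. Math. 23 (1974) 135–152,
  Theorem 1, Lemma 4, Theorem 3. [Stark1974]
* P. J. Cho, R. J. Lemke Oliver, A. Zaman, *Effective Brauer–Siegel theorems for Artin L-functions*,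
  arXiv:2510.02309 (2025), §1.
* O. Bordellès, *Arithmetic Tales* (Universitext), §7.5.3, Theorem 7.24. [Bordelles2020]
* Mathlib, `Mathlib/NumberTheory/NumberField/DedekindZeta.lean` (`dedekindZeta_residue_def`).
-/

noncomputable section


open NumberField NumberField.InfinitePlace NumberField.Units

namespace Summit.QuantumAdvantage.QuantumAdvantage.Theorems.DegreeOnePrimesEscape

namespace Residue

open Literature.NumberTheory.LFunctions Literature.NumberTheory.LFunctions.NumberField

/-! ### The residue: `κ_K ≥ c(n)/log|d_K|` without quadratic subfield -/

/-- **`κ_K ≥ e^{−7}·16^{−n}·(1/(4·n!)) / log|d_K|` for every number field of degree `n > 1` without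
quadratic subfield** (Stark's zero-free interval `[1 − 1/(4·n!·log|d_K|), 1)` in Stark's Lemma 4).
[cite: Stark1974, Lemma 4 and Theorem 3] -/
theorem residue_ge_inv_log_of_noQuadraticSubfield (K : Type) [Field K] [NumberField K]
    (hn : 1 < Module.finrank ℚ K) (hnq : ∀ F : IntermediateField ℚ K, Module.finrank ℚ F ≠ 2) :
    Real.exp (-7) * (1 / 16 : ℝ) ^ Module.finrank ℚ K *
        (1 / (4 * ((Module.finrank ℚ K).factorial : ℝ)) / Real.log ((discr K).natAbs : ℝ)) ≤
      dedekindZeta_residue K := by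
  set n : ℕ := Module.finrank ℚ K with hndef
  have hfac1 : (1 : ℝ) ≤ (n.factorial : ℝ) := by
    exact_mod_cast Nat.one_le_iff_ne_zero.mpr (Nat.factorial_ne_zero n)
  have hc0 : (0 : ℝ) < 1 / (4 * (n.factorial : ℝ)) := by positivity
  have hc4 : 1 / (4 * (n.factorial : ℝ)) ≤ 1 / 4 := by
    rw [div_le_div_iff₀ (by positivity) (by norm_num)]
    linarith
  have hZ : ∀ σ : ℝ, 1 - 1 / (4 * (n.factorial : ℝ)) / Real.log ((discr K).natAbs : ℝ) ≤ σ → σ < 1 →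
      dedekindZetaCont K σ ≠ 0 := by
    intro σ hσ hσ1
    refine Stark1974_dedekindZeta_ne_zero_of_noQuadraticSubfield_holds K hnq σ ?_ hσ1
    rw [← hndef]
    have : 1 / (4 * (n.factorial : ℝ)) / Real.log ((discr K).natAbs : ℝ) =
        1 / (4 * (n.factorial : ℝ) * Real.log ((discr K).natAbs : ℝ)) := by
      rw [div_div]
    linarith
  have hmain := residue_ge_of_zeroFree K hn hc0 hc4 hZ
  rw [← hndef] at hmain
  exact hmain

/-! ### The class number formula turns it into a lower bound for `h_K · R_K` -/

/-- **Effective Brauer–Siegel lower bound without quadratic subfield**: for every number field `K`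
of degree `n > 1` with no quadratic subfield,
`h_K · R_K ≥ (e^{−7} · 16^{−n} / (4·n!·(2π)^n)) · √|d_K| / log|d_K|`.
Proof: `residue_ge_inv_log_of_noQuadraticSubfield` and the analytic class number formula
`κ_K = 2^{r₁}(2π)^{r₂} h_K R_K / (w_K √|d_K|)` (Mathlib's definition of `dedekindZeta_residue`),
with `w_K ≥ 1` and `2^{r₁}(2π)^{r₂} ≤ (2π)^{r₁+r₂} ≤ (2π)^n`. [cite: Stark1974, Theorem 1 (no-quadratic-subfield case), Lemma 4] -/
theorem classNumber_mul_regulator_ge_of_noQuadraticSubfield (K : Type) [Field K] [NumberField K]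
    (hn : 1 < Module.finrank ℚ K) (hnq : ∀ F : IntermediateField ℚ K, Module.finrank ℚ F ≠ 2) :
    Real.exp (-7) * (1 / 16 : ℝ) ^ Module.finrank ℚ K /
          (4 * ((Module.finrank ℚ K).factorial : ℝ) * (2 * Real.pi) ^ Module.finrank ℚ K) *
        (Real.sqrt |(discr K : ℝ)| / Real.log |(discr K : ℝ)|) ≤
      (classNumber K : ℝ) * regulator K := by
  set n : ℕ := Module.finrank ℚ K with hndef
  have hκ := residue_ge_inv_log_of_noQuadraticSubfield K hn hnq
  rw [← hndef] at hκ
  have hdabs : ((discr K).natAbs : ℝ) = |(discr K : ℝ)| := by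
    rw [Nat.cast_natAbs, Int.cast_abs]
  rw [hdabs] at hκ
  -- sizes
  have hd0 : 0 < |(discr K : ℝ)| := abs_pos.mpr (Int.cast_ne_zero.mpr (discr_ne_zero K))
  have hd3 : (3 : ℝ) ≤ |(discr K : ℝ)| := by
    have h2 := NumberField.abs_discr_gt_two hn
    rw [← Int.cast_abs]
    exact_mod_cast (show (3 : ℤ) ≤ |discr K| by omega)
  have hlog0 : 0 < Real.log |(discr K : ℝ)| := Real.log_pos (by linarith)
  have hsqrt0 : 0 < Real.sqrt |(discr K : ℝ)| := Real.sqrt_pos.mpr hd0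
  have hw1 : (1 : ℝ) ≤ torsionOrder K := by exact_mod_cast torsionOrder_pos K
  have hR0 : 0 < regulator K := regulator_pos K
  have hh0 : (0 : ℝ) < classNumber K := by exact_mod_cast classNumber_pos K
  have hπ1 : (1 : ℝ) ≤ 2 * Real.pi := by linarith [Real.pi_gt_three]
  have hπn : (0 : ℝ) < (2 * Real.pi) ^ n := by positivity
  -- the archimedean factor `2^{r₁} (2π)^{r₂} ≤ (2π)^n`
  have harch : (2 : ℝ) ^ nrRealPlaces K * (2 * Real.pi) ^ nrComplexPlaces K ≤ (2 * Real.pi) ^ n := by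
    have hrk : nrRealPlaces K + 2 * nrComplexPlaces K = n := by
      rw [hndef]; exact card_add_two_mul_card_eq_rank K
    calc (2 : ℝ) ^ nrRealPlaces K * (2 * Real.pi) ^ nrComplexPlaces K
        ≤ (2 * Real.pi) ^ nrRealPlaces K * (2 * Real.pi) ^ nrComplexPlaces K := by
          apply mul_le_mul_of_nonneg_right _ (by positivity)
          exact pow_le_pow_left₀ (by norm_num) (by linarith [Real.pi_gt_three]) _
      _ = (2 * Real.pi) ^ (nrRealPlaces K + nrComplexPlaces K) := by rw [pow_add]
      _ ≤ (2 * Real.pi) ^ n := pow_le_pow_right₀ hπ1 (by omega)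
  -- the class number formula gives `κ_K ≤ (2π)^n · h_K R_K / √|d_K|`
  have hκle : dedekindZeta_residue K ≤
      (2 * Real.pi) ^ n * ((classNumber K : ℝ) * regulator K) / Real.sqrt |(discr K : ℝ)| := by
    rw [dedekindZeta_residue_def, div_le_div_iff₀ (by positivity) hsqrt0]
    have hA : (2 : ℝ) ^ nrRealPlaces K * (2 * Real.pi) ^ nrComplexPlaces K * regulator K * classNumber K ≤
        (2 * Real.pi) ^ n * ((classNumber K : ℝ) * regulator K) := by
      have := mul_le_mul_of_nonneg_right harch (le_of_lt (mul_pos hh0 hR0))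
      linarith [this]
    have hB : 0 ≤ (2 * Real.pi) ^ n * ((classNumber K : ℝ) * regulator K) := by positivity
    calc (2 : ℝ) ^ nrRealPlaces K * (2 * Real.pi) ^ nrComplexPlaces K * regulator K * classNumber K *
          Real.sqrt |(discr K : ℝ)|
        ≤ (2 * Real.pi) ^ n * ((classNumber K : ℝ) * regulator K) * Real.sqrt |(discr K : ℝ)| :=
          mul_le_mul_of_nonneg_right hA hsqrt0.le
      _ = (2 * Real.pi) ^ n * ((classNumber K : ℝ) * regulator K) * (1 * Real.sqrt |(discr K : ℝ)|) := by
          rw [one_mul]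
      _ ≤ (2 * Real.pi) ^ n * ((classNumber K : ℝ) * regulator K) *
            (torsionOrder K * Real.sqrt |(discr K : ℝ)|) := by
          apply mul_le_mul_of_nonneg_left _ hB
          exact mul_le_mul_of_nonneg_right hw1 hsqrt0.le
  -- combine the two bounds on `κ_K`
  have key : Real.exp (-7) * (1 / 16 : ℝ) ^ n * (1 / (4 * (n.factorial : ℝ))) *
        Real.sqrt |(discr K : ℝ)| ≤
      (2 * Real.pi) ^ n * ((classNumber K : ℝ) * regulator K) * Real.log |(discr K : ℝ)| := by
    have := hκ.trans hκle
    rw [← mul_div_assoc] at this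
    rwa [div_le_div_iff₀ hlog0 hsqrt0] at this
  have hfin : Real.exp (-7) * (1 / 16 : ℝ) ^ n / (4 * (n.factorial : ℝ) * (2 * Real.pi) ^ n) *
        (Real.sqrt |(discr K : ℝ)| / Real.log |(discr K : ℝ)|) =
      Real.exp (-7) * (1 / 16 : ℝ) ^ n * (1 / (4 * (n.factorial : ℝ))) * Real.sqrt |(discr K : ℝ)| /
        ((2 * Real.pi) ^ n * Real.log |(discr K : ℝ)|) := by
    field_simp
  rw [hfin, div_le_iff₀ (by positivity)]
  calc _ ≤ _ := key
    _ = _ := by ring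

/-- **Every number field of ODD degree `n > 1`** satisfies the same effective lower bound
`h_K · R_K ≥ (e^{−7} · 16^{−n} / (4·n!·(2π)^n)) · √|d_K| / log|d_K|` (an odd-degree field has no
quadratic subfield by the tower law). [cite: Stark1974, Theorem 1 (no-quadratic-subfield case)] -/
theorem classNumber_mul_regulator_ge_of_odd (K : Type) [Field K] [NumberField K]
    (hn : 1 < Module.finrank ℚ K) (hodd : Odd (Module.finrank ℚ K)) :
    Real.exp (-7) * (1 / 16 : ℝ) ^ Module.finrank ℚ K /
          (4 * ((Module.finrank ℚ K).factorial : ℝ) * (2 * Real.pi) ^ Module.finrank ℚ K) *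
        (Real.sqrt |(discr K : ℝ)| / Real.log |(discr K : ℝ)|) ≤
      (classNumber K : ℝ) * regulator K :=
  classNumber_mul_regulator_ge_of_noQuadraticSubfield K hn (forall_finrank_ne_two_of_odd hodd)

/-- **Every CUBIC field**: `√|d_K| ≤ 10¹¹ · h_K · R_K · log|d_K|` (the degree-`3` case with the constant
evaluated: `e⁷ · 16³ · 4 · 3! · (2π)³ < 1097 · 98304 · 249 < 10¹¹`). [cite: Stark1974, Theorem 1 (no-quadratic-subfield case)] -/
theorem sqrt_abs_discr_le_of_finrank_eq_three (K : Type) [Field K] [NumberField K]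
    (hK : Module.finrank ℚ K = 3) :
    Real.sqrt |(discr K : ℝ)| ≤ 10 ^ 11 * ((classNumber K : ℝ) * regulator K) * Real.log |(discr K : ℝ)| := by
  have hodd : Odd (Module.finrank ℚ K) := by rw [hK]; exact ⟨1, by norm_num⟩
  have h := classNumber_mul_regulator_ge_of_odd K (by rw [hK]; norm_num) hodd
  rw [hK] at h
  -- sizes
  have hd3 : (3 : ℝ) ≤ |(discr K : ℝ)| := by
    have h2 := NumberField.abs_discr_gt_two (K := K) (by rw [hK]; norm_num)
    rw [← Int.cast_abs]
    exact_mod_cast (show (3 : ℤ) ≤ |discr K| by omega)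
  have hlog0 : 0 < Real.log |(discr K : ℝ)| := Real.log_pos (by linarith)
  have hsqrt0 : 0 ≤ Real.sqrt |(discr K : ℝ)| := Real.sqrt_nonneg _
  have hhR : 0 < (classNumber K : ℝ) * regulator K :=
    mul_pos (by exact_mod_cast classNumber_pos K) (regulator_pos K)
  -- the constant: `1/10¹¹ ≤ e^{-7} 16^{-3} / (4 · 3! · (2π)³)`
  have he7 : Real.exp 7 < 1097 := by
    have h1 := Real.exp_one_lt_d9
    have h7 : Real.exp 7 = Real.exp 1 ^ 7 := by rw [← Real.exp_nat_mul]; norm_num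
    rw [h7]
    have : Real.exp 1 ^ 7 < 2.7182818286 ^ 7 := pow_lt_pow_left₀ h1 (Real.exp_pos _).le (by norm_num)
    linarith [show (2.7182818286 : ℝ) ^ 7 < 1097 by norm_num]
  have hP : (2 * Real.pi) ^ 3 < 249 := by
    have hπ := Real.pi_lt_d4
    have h0 : 0 < 2 * Real.pi := by linarith [Real.pi_gt_three]
    have : (2 * Real.pi) ^ 3 < (2 * 3.1416) ^ 3 := pow_lt_pow_left₀ (by linarith) h0.le (by norm_num)
    linarith [show ((2 : ℝ) * 3.1416) ^ 3 < 249 by norm_num]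
  have hE0 : 0 < Real.exp 7 := Real.exp_pos 7
  have hP0 : 0 < (2 * Real.pi) ^ 3 := by positivity
  have hconst : (1 : ℝ) / 10 ^ 11 ≤
      Real.exp (-7) * (1 / 16 : ℝ) ^ 3 / (4 * ((3 : ℕ).factorial : ℝ) * (2 * Real.pi) ^ 3) := by
    have hrw : Real.exp (-7) * (1 / 16 : ℝ) ^ 3 / (4 * ((3 : ℕ).factorial : ℝ) * (2 * Real.pi) ^ 3) =
        1 / (Real.exp 7 * 98304 * (2 * Real.pi) ^ 3) := by
      rw [Real.exp_neg]
      norm_num [Nat.factorial]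
      field_simp
      ring
    rw [hrw]
    apply one_div_le_one_div_of_le (by positivity)
    have := mul_le_mul he7.le hP.le hP0.le (by norm_num)
    nlinarith [this]
  -- combine
  have hq : 0 ≤ Real.sqrt |(discr K : ℝ)| / Real.log |(discr K : ℝ)| := by positivity
  have h2 : (1 : ℝ) / 10 ^ 11 * (Real.sqrt |(discr K : ℝ)| / Real.log |(discr K : ℝ)|) ≤
      (classNumber K : ℝ) * regulator K := (mul_le_mul_of_nonneg_right hconst hq).trans h
  rw [one_div, ← div_eq_inv_mul, div_le_iff₀ (by positivity), div_le_iff₀ hlog0] at h2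
  linarith [h2]

/-! ### `∃ c(n) > 0` packagings -/

/-- For every `n > 1` there is an explicit `c = c(n) > 0` with `h_K · R_K ≥ c · √|d_K| / log|d_K|` for
every number field `K` of degree `n` without quadratic subfield. [cite: Stark1974, Theorem 1 (no-quadratic-subfield case)] -/
theorem exists_classNumber_mul_regulator_ge (n : ℕ) (hn : 1 < n) :
    ∃ c : ℝ, 0 < c ∧ ∀ (K : Type) [Field K] [NumberField K], Module.finrank ℚ K = n →
      (∀ F : IntermediateField ℚ K, Module.finrank ℚ F ≠ 2) →
      c * (Real.sqrt |(discr K : ℝ)| / Real.log |(discr K : ℝ)|) ≤ (classNumber K : ℝ) * regulator K := by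
  refine ⟨Real.exp (-7) * (1 / 16 : ℝ) ^ n / (4 * (n.factorial : ℝ) * (2 * Real.pi) ^ n), ?_,
    fun K _ _ hK hnq => ?_⟩
  · have : (0 : ℝ) < 2 * Real.pi := by linarith [Real.pi_gt_three]
    positivity
  · subst hK
    exact classNumber_mul_regulator_ge_of_noQuadraticSubfield K hn hnq

/-- For every ODD `n > 1` there is an explicit `c = c(n) > 0` with `h_K · R_K ≥ c · √|d_K| / log|d_K|`
for EVERY number field `K` of degree `n`. [cite: Stark1974, Theorem 1 (no-quadratic-subfield case)] -/
theorem exists_classNumber_mul_regulator_ge_of_odd (n : ℕ) (hn : 1 < n) (hodd : Odd n) :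
    ∃ c : ℝ, 0 < c ∧ ∀ (K : Type) [Field K] [NumberField K], Module.finrank ℚ K = n →
      c * (Real.sqrt |(discr K : ℝ)| / Real.log |(discr K : ℝ)|) ≤ (classNumber K : ℝ) * regulator K := by
  obtain ⟨c, hc, h⟩ := exists_classNumber_mul_regulator_ge n hn
  refine ⟨c, hc, fun K _ _ hK => h K hK (forall_finrank_ne_two_of_odd ?_)⟩
  rw [hK]; exact hodd

end Residue

end Summit.QuantumAdvantage.QuantumAdvantage.Theorems.DegreeOnePrimesEscape

end
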